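import Mathlib
import Literature.Geometry.DiscreteGeometry.DelaunaySubdivision
import HarnessLib

/-!
# SquareWellLayerCake · `AveragedTwelve` — every interior triangle is shared by exactly two cells
(stub `stub_twoCellsPerFace`)

Stub `stub_twoCellsPerFace` of line `Sketch` (idea `par-five-delaunay-recount`) of crux
`SquareWellLayerCake.AveragedTwelve` (item stmt-AtomisticToContinuum-15806), route
`AtomisticToContinuum/Crystallization/SquareWellLayerCake`.

TWO CELLS PER INTERIOR FACE: let `K` be a triangulation
(`Literature.Geometry.DiscreteGeometry.IsTriangulation`) of a finite set of sites `ω ⊂ ℝ³` and let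
`σ` be a triangle of `K` (a simplex with `3` vertices) one of whose vertices is interior to
`conv ω`.  Then exactly two cells of `K` (simplices with `4` vertices) contain `σ`.

## Proof

Euclidean geometry and the simplicial-complex axioms only.

* A normal vector: `vectorSpan σ` has dimension `≤ 2 < 3`, so some `n ≠ 0` is orthogonal to it,
  i.e. the linear function `⟪n, ·⟫` takes a constant value `μ` on `σ` (hence on `conv σ`).  A cell
  `t ⊇ σ` affinely spans `ℝ³`, so some vertex of `t` has `⟪n, ·⟫ ≠ μ`: every cell through `σ` has
  a vertex strictly above or strictly below the plane of `σ`, and not both (it has only one vertex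
  outside `σ`).
* The point `m := v/3 + (2/3)·(midpoint of the other two vertices)` lies in `conv σ`, in no proper
  face of `σ` (barycentric coordinates `1/3`, uniqueness of weights for the affinely independent
  `σ`), and in the interior of `conv ω` (`Convex.combo_interior_closure_mem_interior`).  By the
  tree lemma `IsTriangulation.biUnion_cells_mem_nhds` the closed cells through `σ` cover a ball
  `B(m, r)`.
* At least two cells: the points `m ± c • n` of the ball are covered by cells through `σ`; a cell
  covering `m + c • n` must have a vertex strictly above the plane, one covering `m - c • n` a
  vertex strictly below; these are two distinct cells.
* At most two cells: if two distinct cells `t ≠ t'` through `σ` both have a vertex strictly above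
  the plane, pick points `x ∈ conv t`, `x' ∈ conv t'` strictly above the plane inside the ball.
  The open upper half-ball `O` is connected and covered by the closed set `conv t` together with
  the closed union of the other cells through `σ`; both meet `O` (at `x`, resp. `x'`), so they meet
  inside `O` at a point of `conv t ∩ conv s = conv (t ∩ s) = conv σ` (`s ≠ t` another cell through
  `σ`), which lies ON the plane — a contradiction.  Symmetrically below.  Hence the cells through
  `σ` are at most one above plus at most one below.
-/

noncomputable section

namespace Summit.AtomisticToContinuum.Crystallization.Theorems.ParFiveRecountTwoCells

open Metric Set
open scoped RealInnerProductSpace Topology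
open Literature.Geometry.DiscreteGeometry

variable {V : Type*} [NormedAddCommGroup V] [InnerProductSpace ℝ V]

/-- `⟪n, ·⟫` is a linear map. [folklore] -/
theorem isLinearMap_inner (n : V) : IsLinearMap ℝ fun y : V => ⟪n, y⟫ :=
  ⟨fun x y => inner_add_right n x y, fun c x => real_inner_smul_right n x c⟩

/-- A linear function constant (`= μ`) on the vertices of `σ` is constant on `conv σ`.
[folklore] -/
theorem inner_eq_of_mem_convexHull {σ : Finset V} {n : V} {μ : ℝ} (hσμ : ∀ p ∈ σ, ⟪n, p⟫ = μ)
    {x : V} (hx : x ∈ convexHull ℝ (σ : Set V)) : ⟪n, x⟫ = μ :=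
  convexHull_min (fun p hp => (hσμ p hp : p ∈ {w : V | ⟪n, w⟫ = μ}))
    (convex_hyperplane (isLinearMap_inner n) μ) hx

/-- **A normal vector to a triangle in `3`-space**: if `σ` has at most `3` points (`σ.card = 3`)
in a `3`-dimensional inner product space, some `n ≠ 0` has `⟪n, ·⟫` constant on `σ`. [folklore] -/
theorem exists_normal [FiniteDimensional ℝ V] (hV : Module.finrank ℝ V = 3) {σ : Finset V}
    (hσ3 : σ.card = 3) {v : V} (hv : v ∈ σ) :
    ∃ n : V, n ≠ 0 ∧ ∀ p ∈ σ, ⟪n, p⟫ = ⟪n, v⟫ := by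
  classical
  set W : Submodule ℝ V := vectorSpan ℝ (σ : Set V) with hW
  have hW2 : Module.finrank ℝ W ≤ 2 := by
    have h := finrank_vectorSpan_image_finset_le ℝ (id : V → V) σ (n := 2) (by rw [hσ3])
    rwa [Finset.image_id] at h
  have hsum := Submodule.finrank_add_finrank_orthogonal W
  have hne : Wᗮ ≠ ⊥ := fun h0 => by
    rw [h0, finrank_bot, hV] at hsum
    omega
  obtain ⟨n, hnW, hn0⟩ := Submodule.exists_mem_ne_zero_of_ne_bot hne
  refine ⟨n, hn0, fun p hp => ?_⟩
  have h := Submodule.inner_left_of_mem_orthogonal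
    (vsub_mem_vectorSpan ℝ (Finset.mem_coe.2 hp) (Finset.mem_coe.2 hv)) hnW
  rwa [vsub_eq_sub, inner_sub_right, sub_eq_zero] at h

/-- **Cells are not flat**: a simplex of a complex with `dim V + 1` vertices has, for every
nonzero `n` and every level `μ`, a vertex `q` with `⟪n, q⟫ ≠ μ`. [folklore] -/
theorem exists_inner_ne [FiniteDimensional ℝ V] (K : Geometry.SimplicialComplex ℝ V)
    {t : Finset V} (ht : t ∈ K.faces) (hcard : t.card = Module.finrank ℝ V + 1) {n : V}
    (hn : n ≠ 0) (μ : ℝ) : ∃ q ∈ t, ⟪n, q⟫ ≠ μ := by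
  by_contra h
  push Not at h
  have htop : affineSpan ℝ (t : Set V) = ⊤ := (affineSpan_eq_top_iff_card K ht).2 hcard
  have hdir : vectorSpan ℝ (t : Set V) = ⊤ := by
    rw [← direction_affineSpan, htop, AffineSubspace.direction_top]
  have hle : vectorSpan ℝ (t : Set V) ≤ (ℝ ∙ n)ᗮ := by
    rw [vectorSpan_def]
    refine Submodule.span_le.2 ?_
    rintro _ ⟨p₁, hp₁, p₂, hp₂, rfl⟩
    rw [SetLike.mem_coe, Submodule.mem_orthogonal_singleton_iff_inner_right]
    show ⟪n, p₁ - p₂⟫ = 0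
    rw [inner_sub_right, h p₁ hp₁, h p₂ hp₂, sub_self]
  rw [hdir, top_le_iff, Submodule.orthogonal_eq_top_iff, Submodule.span_singleton_eq_bot] at hle
  exact hn hle

/-- **A relative-interior point of a triangle at an interior vertex.** For a triangle `σ` of a
complex with a vertex `v` interior to a convex set `A ⊇ conv σ`, the point
`m = v/3 + (2/3)·(midpoint of the opposite edge)` lies in `conv σ`, in no proper face of `σ`, and
in the interior of `A`. [folklore] -/
theorem exists_relint (K : Geometry.SimplicialComplex ℝ V) {σ : Finset V} (hσ : σ ∈ K.faces)
    (hσ3 : σ.card = 3) {v : V} (hv : v ∈ σ) {A : Set V} (hA : Convex ℝ A)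
    (hσA : convexHull ℝ (σ : Set V) ⊆ A) (hvint : v ∈ interior A) :
    ∃ m, m ∈ convexHull ℝ (σ : Set V) ∧ (∀ ρ, ρ ⊂ σ → m ∉ convexHull ℝ (ρ : Set V)) ∧
      m ∈ interior A := by
  classical
  set τ : Finset V := σ.erase v with hτ
  have hτ2 : τ.card = 2 := by rw [hτ, Finset.card_erase_of_mem hv, hσ3]
  set c : V := ∑ p ∈ τ, (2⁻¹ : ℝ) • p with hc
  have hcτ : c ∈ convexHull ℝ (τ : Set V) :=
    Finset.mem_convexHull'.2 ⟨fun _ => 2⁻¹, fun _ _ => by positivity,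
      by rw [Finset.sum_const, hτ2]; norm_num, rfl⟩
  have hτσ : convexHull ℝ (τ : Set V) ⊆ convexHull ℝ (σ : Set V) :=
    convexHull_mono (Finset.coe_subset.2 (Finset.erase_subset v σ))
  refine ⟨(3⁻¹ : ℝ) • v + (2 / 3 : ℝ) • c, ?_, fun ρ hρ hmρ => ?_, ?_⟩
  · exact convex_convexHull ℝ _ (subset_convexHull ℝ _ (Finset.mem_coe.2 hv)) (hτσ hcτ)
      (by norm_num) (by norm_num) (by norm_num)
  · -- `m` is the uniform combination of the vertices of `σ`
    have hm : ∑ p ∈ σ, (3⁻¹ : ℝ) • p = (3⁻¹ : ℝ) • v + (2 / 3 : ℝ) • c := by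
      rw [← Finset.add_sum_erase σ _ hv, hc, Finset.smul_sum]
      congr 1
      refine Finset.sum_congr rfl fun p _ => ?_
      rw [smul_smul]
      norm_num
    obtain ⟨w, -, hw1, hwm⟩ := Finset.mem_convexHull'.1 hmρ
    obtain ⟨p₀, hp₀σ, hp₀ρ⟩ := Finset.exists_of_ssubset hρ
    have hw'1 : ∑ p ∈ σ, (if p ∈ ρ then w p else 0) = 1 := by
      rw [Finset.sum_ite_mem, Finset.inter_eq_right.2 hρ.1, hw1]
    have hw'm : ∑ p ∈ σ, (if p ∈ ρ then w p else 0) • p = ∑ p ∈ σ, (3⁻¹ : ℝ) • p := by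
      simp only [ite_smul, zero_smul]
      rw [Finset.sum_ite_mem, Finset.inter_eq_right.2 hρ.1, hwm, hm]
    have h3 : ∑ _p ∈ σ, (3⁻¹ : ℝ) = 1 := by rw [Finset.sum_const, hσ3]; norm_num
    have h := (K.indep hσ).eq_of_sum_eq_sum_subtype (w₁ := fun p => if p ∈ ρ then w p else 0)
      (w₂ := fun _ => (3⁻¹ : ℝ)) (by rw [hw'1, h3]) hw'm p₀ hp₀σ
    simp only [hp₀ρ, if_false] at h
    norm_num at h
  · exact hA.combo_interior_closure_mem_interior hvint (subset_closure (hσA (hτσ hcτ)))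
      (by norm_num) (by norm_num) (by norm_num)

/-- **A cell above the plane.** If the closed simplices of a family `S` cover a ball about a point
`m` of the plane `⟪n, ·⟫ = μ` (`n ≠ 0`), some member of `S` has a vertex strictly above the plane.
[folklore] -/
theorem exists_vertex_gt {S : Set (Finset V)} {m n : V} {μ r : ℝ} (hn : n ≠ 0) (hm : ⟪n, m⟫ = μ)
    (hr : 0 < r) (hcov : ball m r ⊆ ⋃ s ∈ S, convexHull ℝ (s : Set V)) :
    ∃ s ∈ S, ∃ q ∈ s, μ < ⟪n, q⟫ := by
  have hn0 : 0 < ‖n‖ := norm_pos_iff.2 hn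
  set c : ℝ := r / (2 * ‖n‖) with hc
  have hcpos : 0 < c := by positivity
  have hx : m + c • n ∈ ball m r := by
    rw [mem_ball, dist_eq_norm, add_sub_cancel_left, norm_smul, Real.norm_of_nonneg hcpos.le, hc,
      div_mul_eq_mul_div, div_lt_iff₀ (by positivity)]
    nlinarith
  obtain ⟨s, hs, hxs⟩ := Set.mem_iUnion₂.1 (hcov hx)
  refine ⟨s, hs, ?_⟩
  by_contra hle
  push Not at hle
  have h1 : ⟪n, m + c • n⟫ ≤ μ :=
    convexHull_min (fun q hq => (hle q hq : q ∈ {w : V | ⟪n, w⟫ ≤ μ}))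
      (convex_halfSpace_le (isLinearMap_inner n) μ) hxs
  rw [inner_add_right, real_inner_smul_right, hm, real_inner_self_eq_norm_sq] at h1
  have h2 : 0 < c * ‖n‖ ^ 2 := by positivity
  linarith

/-- **At most one cell above the plane.** Let `S` be a finite family of simplices of a complex
`K`, each containing `σ` and having one more vertex than `σ`, whose closed simplices cover a ball
about a point `m ∈ conv σ`, where `⟪n, ·⟫ = μ` on `σ`.  Then at most one member of `S` has a
vertex strictly above the plane: two such cells `t ≠ t'` would give points `x ∈ conv t`,
`x' ∈ conv t'` of the (connected) open upper half-ball, which is covered by the closed set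
`conv t` and the closed union of the other members; a common point lies in
`conv t ∩ conv s = conv σ`, i.e. on the plane. [folklore] -/
theorem eq_of_vertex_gt (K : Geometry.SimplicialComplex ℝ V)
    {S : Set (Finset V)} (hSfin : S.Finite) {σ : Finset V}
    (hS : ∀ s ∈ S, s ∈ K.faces ∧ σ ⊆ s ∧ s.card = σ.card + 1) {n m : V} {μ r : ℝ}
    (hσμ : ∀ p ∈ σ, ⟪n, p⟫ = μ) (hmσ : m ∈ convexHull ℝ (σ : Set V)) (hr : 0 < r)
    (hcov : ball m r ⊆ ⋃ s ∈ S, convexHull ℝ (s : Set V)) {t t' : Finset V} (ht : t ∈ S)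
    (ht' : t' ∈ S) (hq : ∃ q ∈ t, μ < ⟪n, q⟫) (hq' : ∃ q ∈ t', μ < ⟪n, q⟫) : t = t' := by
  classical
  by_contra hne
  have hm : ⟪n, m⟫ = μ := inner_eq_of_mem_convexHull hσμ hmσ
  -- a point of `conv s` strictly above the plane inside the ball
  have hpt : ∀ s ∈ S, (∃ q ∈ s, μ < ⟪n, q⟫) →
      ∃ x ∈ ball m r ∩ {y : V | μ < ⟪n, y⟫}, x ∈ convexHull ℝ (s : Set V) := by
    rintro s hs ⟨q, hq, hμq⟩
    set ε : ℝ := r / (2 * (r + ‖q - m‖)) with hε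
    have hD : 0 < r + ‖q - m‖ := by positivity
    have hε0 : 0 < ε := by positivity
    have hε1 : ε ≤ 1 := by
      rw [hε, div_le_one (by positivity)]
      nlinarith [norm_nonneg (q - m)]
    refine ⟨m + ε • (q - m), ⟨?_, ?_⟩, ?_⟩
    · rw [mem_ball, dist_eq_norm, add_sub_cancel_left, norm_smul, Real.norm_of_nonneg hε0.le, hε,
        div_mul_eq_mul_div, div_lt_iff₀ (by positivity)]
      nlinarith [norm_nonneg (q - m)]
    · show μ < ⟪n, m + ε • (q - m)⟫
      rw [inner_add_right, real_inner_smul_right, inner_sub_right, hm]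
      nlinarith
    · exact (convex_convexHull ℝ _).add_smul_sub_mem
        (convexHull_mono (Finset.coe_subset.2 (hS s hs).2.1) hmσ)
        (subset_convexHull ℝ _ (Finset.mem_coe.2 hq)) ⟨hε0.le, hε1⟩
  -- the connectedness argument
  have hO : IsPreconnected (ball m r ∩ {y : V | μ < ⟪n, y⟫}) :=
    ((convex_ball m r).inter (convex_halfSpace_gt (isLinearMap_inner n) μ)).isPreconnected
  have hA : IsClosed (convexHull ℝ (t : Set V)) := t.finite_toSet.isClosed_convexHull ℝ
  have hB : IsClosed (⋃ s ∈ hSfin.toFinset.erase t, convexHull ℝ (s : Set V)) :=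
    isClosed_biUnion_finset fun s _ => s.finite_toSet.isClosed_convexHull ℝ
  have hcov' : ball m r ∩ {y : V | μ < ⟪n, y⟫} ⊆
      convexHull ℝ (t : Set V) ∪ ⋃ s ∈ hSfin.toFinset.erase t, convexHull ℝ (s : Set V) := by
    rintro y ⟨hy, -⟩
    obtain ⟨s, hs, hys⟩ := Set.mem_iUnion₂.1 (hcov hy)
    by_cases hst : s = t
    · exact Or.inl (hst ▸ hys)
    · exact Or.inr (Set.mem_iUnion₂.2 ⟨s, Finset.mem_erase.2 ⟨hst, hSfin.mem_toFinset.2 hs⟩, hys⟩)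
  obtain ⟨x, hxO, hxt⟩ := hpt t ht hq
  obtain ⟨x', hx'O, hx't'⟩ := hpt t' ht' hq'
  obtain ⟨y, hyO, hyt, hyB⟩ := isPreconnected_closed_iff.1 hO _ _ hA hB hcov' ⟨x, hxO, hxt⟩
    ⟨x', hx'O, Set.mem_iUnion₂.2
      ⟨t', Finset.mem_erase.2 ⟨Ne.symm hne, hSfin.mem_toFinset.2 ht'⟩, hx't'⟩⟩
  obtain ⟨s, hs, hys⟩ := Set.mem_iUnion₂.1 hyB
  obtain ⟨hst, hsS⟩ := Finset.mem_erase.1 hs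
  have hsS' : s ∈ S := hSfin.mem_toFinset.1 hsS
  -- `y ∈ conv t ∩ conv s = conv (t ∩ s) = conv σ` lies on the plane
  have hy : y ∈ convexHull ℝ (↑(t ∩ s) : Set V) := by
    rw [Finset.coe_inter, ← K.convexHull_inter_convexHull (hS t ht).1 (hS s hsS').1]
    exact ⟨hyt, hys⟩
  have hts : t ∩ s = σ := by
    symm
    refine Finset.eq_of_subset_of_card_le (Finset.subset_inter (hS t ht).2.1 (hS s hsS').2.1) ?_
    have h1 : t ∩ s ⊂ t := by
      refine Finset.ssubset_iff_subset_ne.2 ⟨Finset.inter_subset_left, fun h => hst ?_⟩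
      exact (Finset.eq_of_subset_of_card_le (Finset.inter_eq_left.1 h)
        (by rw [(hS t ht).2.2, (hS s hsS').2.2])).symm
    have h2 := Finset.card_lt_card h1
    rw [(hS t ht).2.2] at h2
    omega
  rw [hts] at hy
  exact absurd (inner_eq_of_mem_convexHull hσμ hy) (ne_of_gt hyO.2)

/-- Stub `stub_twoCellsPerFace` of line `Sketch` of crux `SquareWellLayerCake.AveragedTwelve`:
**in a triangulation of a finite point set of `ℝ³`, a triangle with a vertex interior to the
convex hull of the sites is a face of exactly two tetrahedra.** [folklore] -/
theorem stub_twoCellsPerFace : ∀ (ω : Finset (EuclideanSpace ℝ (Fin 3))) (K : Geometry.SimplicialComplex ℝ (EuclideanSpace ℝ (Fin 3))), Literature.Geometry.DiscreteGeometry.IsTriangulation (↑ω : Set (EuclideanSpace ℝ (Fin 3))) K → ∀ (σ : Finset (EuclideanSpace ℝ (Fin 3))), σ ∈ K.faces → σ.card = 3 → (∃ v ∈ σ, v ∈ interior (convexHull ℝ (↑ω : Set (EuclideanSpace ℝ (Fin 3))))) → ∀ (C : Finset (Finset (EuclideanSpace ℝ (Fin 3)))), (∀ t, t ∈ C ↔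 t ∈ K.faces ∧ t.card = 4 ∧ σ ⊆ t) → C.card = 2 := by
  classical
  intro ω K h σ hσ hσ3 hv C hC
  obtain ⟨v, hvσ, hvint⟩ := hv
  have hdim : Module.finrank ℝ (EuclideanSpace ℝ (Fin 3)) = 3 := finrank_euclideanSpace_fin
  -- a normal vector `n` to the plane of `σ`, level `μ`
  obtain ⟨n, hn, hσμ⟩ := exists_normal hdim hσ3 hvσ
  set μ : ℝ := ⟪n, v⟫ with hμ
  -- a relative-interior point `m` of `σ` interior to `conv ω`; the cells through `σ` cover a ball
  obtain ⟨m, hmσ, hrel, hmint⟩ := exists_relint K hσ hσ3 hvσ (convex_convexHull ℝ _)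
    (h.convexHull_subset hσ) hvint
  have hU := h.biUnion_cells_mem_nhds ω.finite_toSet hσ hmσ hrel hmint
  rw [hdim] at hU
  obtain ⟨r, hr, hball⟩ := Metric.mem_nhds_iff.1 hU
  set S : Set (Finset (EuclideanSpace ℝ (Fin 3))) :=
    {t ∈ K.faces | σ ⊆ t ∧ t.card = 3 + 1} with hS_def
  have hSC : ∀ s, s ∈ S ↔ s ∈ C := fun s => by
    rw [hC, hS_def, Set.mem_setOf_eq]
    exact ⟨fun hs => ⟨hs.1, hs.2.2, hs.2.1⟩, fun hs => ⟨hs.1, hs.2.2, hs.2.1⟩⟩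
  have hS : ∀ s ∈ S, s ∈ K.faces ∧ σ ⊆ s ∧ s.card = σ.card + 1 := fun s hs =>
    ⟨hs.1, hs.2.1, by rw [hσ3]; exact hs.2.2⟩
  have hSfin : S.Finite := (h.finite_faces ω.finite_toSet).subset fun s hs => hs.1
  have hmμ : ⟪n, m⟫ = μ := inner_eq_of_mem_convexHull hσμ hmσ
  have hσμ' : ∀ p ∈ σ, ⟪-n, p⟫ = -μ := fun p hp => by rw [inner_neg_left, hσμ p hp]
  have hmμ' : ⟪-n, m⟫ = -μ := by rw [inner_neg_left, hmμ]
  -- a cell above and a cell below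
  obtain ⟨t₁, ht₁, hq₁⟩ := exists_vertex_gt hn hmμ hr hball
  obtain ⟨t₂, ht₂, hq₂⟩ := exists_vertex_gt (neg_ne_zero.2 hn) hmμ' hr hball
  have hne : t₁ ≠ t₂ := by
    rintro rfl
    obtain ⟨q₁, hq₁t, hq₁μ⟩ := hq₁
    obtain ⟨q₂, hq₂t, hq₂μ⟩ := hq₂
    rw [inner_neg_left, neg_lt_neg_iff] at hq₂μ
    have hq₁σ : q₁ ∉ σ := fun h' => by rw [hσμ q₁ h'] at hq₁μ; exact lt_irrefl _ hq₁μ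
    have hq₂σ : q₂ ∉ σ := fun h' => by rw [hσμ q₂ h'] at hq₂μ; exact lt_irrefl _ hq₂μ
    have hcard : (t₁ \ σ).card = 1 := by
      rw [Finset.card_sdiff_of_subset (hS t₁ ht₁).2.1, (hS t₁ ht₁).2.2]
      simp
    have h12 := Finset.card_le_one.1 hcard.le q₁ (Finset.mem_sdiff.2 ⟨hq₁t, hq₁σ⟩) q₂
      (Finset.mem_sdiff.2 ⟨hq₂t, hq₂σ⟩)
    rw [h12] at hq₁μ
    exact lt_asymm hq₁μ hq₂μ
  have h2 : 2 ≤ C.card :=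
    Finset.one_lt_card.2 ⟨t₁, (hSC t₁).1 ht₁, t₂, (hSC t₂).1 ht₂, hne⟩
  -- at most one cell above and at most one below
  have h3 : C.card ≤ 2 := by
    let P : Finset (EuclideanSpace ℝ (Fin 3)) → Prop := fun t => ∃ q ∈ t, μ < ⟪n, q⟫
    let N : Finset (EuclideanSpace ℝ (Fin 3)) → Prop := fun t => ∃ q ∈ t, -μ < ⟪-n, q⟫
    have hcov : C ⊆ C.filter P ∪ C.filter N := by
      intro t ht
      rw [Finset.mem_union, Finset.mem_filter, Finset.mem_filter]
      have htS := (hSC t).2 ht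
      obtain ⟨q, hq, hqμ⟩ := exists_inner_ne K htS.1 (by rw [hdim]; exact htS.2.2) hn μ
      rcases lt_or_gt_of_ne hqμ with hlt | hgt
      · exact Or.inr ⟨ht, q, hq, by rw [inner_neg_left]; linarith⟩
      · exact Or.inl ⟨ht, q, hq, hgt⟩
    have hP : (C.filter P).card ≤ 1 := Finset.card_le_one.2 fun t ht t' ht' => by
      rw [Finset.mem_filter] at ht ht'
      exact eq_of_vertex_gt K hSfin hS hσμ hmσ hr hball ((hSC t).2 ht.1) ((hSC t').2 ht'.1)
        ht.2 ht'.2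
    have hN : (C.filter N).card ≤ 1 := Finset.card_le_one.2 fun t ht t' ht' => by
      rw [Finset.mem_filter] at ht ht'
      exact eq_of_vertex_gt K hSfin hS hσμ' hmσ hr hball ((hSC t).2 ht.1) ((hSC t').2 ht'.1)
        ht.2 ht'.2
    calc C.card ≤ (C.filter P ∪ C.filter N).card := Finset.card_le_card hcov
      _ ≤ (C.filter P).card + (C.filter N).card := Finset.card_union_le _ _
      _ ≤ 2 := by omega
  omega

end Summit.AtomisticToContinuum.Crystallization.Theorems.ParFiveRecountTwoCells

end
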